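import Summits.ABC.IUTFork.Joshi.TensorPacketsJoshi
import Summits.ABC.IUTFork.Thm311Multirad
import Mathlib.Algebra.Group.Subgroup.Lattice
import HarnessLib

/-!
# [J-III] §9.4 — the tensor-packet codomain, III: carrier-level moves on `𝓘^ℚ_Mochizuki` versus OUR (Ind1)/(Ind2)
# (block E of the abc-iut cell, rung LADDER-ABC:A2.E, slot T-20 = seat abc-iut-E-t20; support for dictionary rows D-04 / D-10)

Sequel of `Summits/ABC/IUTFork/Joshi/TensorPacketsJoshi.lean` (K. Joshi, arXiv:2401.13508 **v4** = `Joshi2024ATS3`, §9.4,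
render `HOME/lit/renders/Joshi-arxiv-2401.13508/`, "p.N l.a–b"; same carriers and flags). TAKES NO SIDE on [IUTchIII]
Cor. 3.12, on Joshi's claims, or on Mochizuki's report on them; typed ≠ proved; typed AS A CANDIDATE ≠ endorsed; the
cell locates / conditionally verifies — NO abc claim.

WHAT THIS FILE RECORDS (kernel bookkeeping, no new hypothesis). Every move Joshi lets act on the theta-values codomain
acts, in §9.4's construction, through ISOMORPHISMS OF THE LOCAL LOG-SHELL CARRIERS `𝓘^{ℚ_p}(L'_w)_y`: the "abstract
isomorphisms `𝓘_{p,y_j} ≃ 𝓘_{p,y_{ℓ*}}`" of Rmk. 9.4.8.2 (p.105 l.53–56, amphoricity Prop. 9.2.1.5), the Galois /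
`Aut(G)`-actions and, read summand by summand, the collation isomorphisms of Prop. 9.7.5.1 (p.112; slot T-21, row
D-10). §1 types the induced isomorphism of the packets `^{S_{j+1}}𝓘^{ℚ_p}_p(L')` and of `𝓘^ℚ_Mochizuki(L')` — `⊗_a (⊕_w
e_{z_a,w})` (`packetCongr`, `IQMochizukiCongr`; Mathlib `PiTensorProduct.congr`). §2 is the point for block E's test
(plan/E/E-PLAN.md §2 "load-bearing sentence", rows D-04/D-10, E-cx's first question): under the strictification
dictionary D-09 of the first file (`ofLogShells L`: one carrier `log(𝒟^⊢_w)` per place, the arithmeticoid forgotten —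
Joshi's own (9.4.8.3) "forgetting the `y_j` … as [Mochizuki, 2021a,b,c] does", p.105 l.65–66), such a carrier-level
move is LITERALLY one of OUR packet automorphisms `LogShells.factorwise j p (fun a => LogShells.summandwise p (g a))`
(`packetCongr_ofLogShells`, `rfl`), and therefore:
* it lies in OUR **(Ind2)** at `(j, p)` as soon as every local isomorphism is an element of `Ism` at its place
  (`packetCongr_mem_Ind2`; [IUTchIII] Thm. 3.11 (i) (Ind2) "independent copies of Ism on each of the direct
  summands of the `j+1` factors" = `Thm311.LogShells.Ind2`), and the whole family over `(j, v_ℚ)` lies in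
  `LogShells.Ind2Family` (`strictMove_mem_Ind2Family`);
* it lies in OUR **(Ind1)** at `j` (with trivial permutation of `S_{j+1}`) as soon as every local isomorphism is a
  `𝒟^⊢`-prime-strip automorphism, uniformly in `v_ℚ` (`packetCongr_mem_Ind1`, `strictMove_mem_Ind1Family`;
  `Thm311.LogShells.Ind1`);
* in either case it lies in the subgroup `Subgroup.closure (Ind1Family ∪ Ind2Family)` over which the residual
  sentence S = `Cor312Vol.PilotKummerIndRelated` and E-plan's `Joshi.Dictionary.MovesAreInd` quantify
  (`strictMove_mem_indClosure`).
These are SUFFICIENT conditions, stated and proved; whether Joshi's amphoric / collation isomorphisms ("all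
(topological) isomorphisms", p.112 l.65–70 — wider than isometries) satisfy them at the real instantiation of
`LogShells` is exactly the open dictionary question D-10 / Y1 (E-cx, E-ref), NOT settled here. Joshi's tuples are
ordered (`(z_0,…,z_{ℓ*})`, §9.4.4), so no permutation of `S_{j+1}` arises from §9.4 (the `σ`-part of (Ind1) is the
identity below). Deliberately NOT here: any claim that a specific Joshi move IS such a `g` (rows D-04/D-10 are
E-plan's `Dictionary.real` / slot T-21's business), any TEST against S, any judgement.
-/

noncomputable section

namespace Summit.ABC.IUTFork.Joshi

open Thm311 Literature.IUT.LogThetaLattice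
open scoped TensorProduct

variable {T : ThetaIndex}

namespace TensorPacketDatum

variable (𝔇 : TensorPacketDatum T)

/-! ## 1. Carrier-level isomorphisms act on the packets and on `𝓘^ℚ_Mochizuki` -/

section Congr

variable (𝕜 : Type) [Field 𝕜]
variable {IQ IQ' : 𝔇.Arith → T.V → Type} [∀ y w, AddCommGroup (IQ y w)] [∀ y w, Module 𝕜 (IQ y w)]
  [∀ y w, AddCommGroup (IQ' y w)] [∀ y w, Module 𝕜 (IQ' y w)]

/-- The isomorphism `^{S_{j+1}}𝓘^{ℚ_p}_p(L') ≃ ^{S_{j+1}}𝓘'^{ℚ_p}_p(L')`, `⊗_a (x_{a,w})_w ↦ ⊗_a (e_{z_a,w} x_{a,w})_w`, induced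
by a family of ISOMORPHISMS of the local log-shell carriers `e_{y,w} : 𝓘^{ℚ_p}(L'_w)_y ≃ 𝓘'^{ℚ_p}(L'_w)_y` — the shape
in which Rmk. 9.4.8.2's "abstract isomorphisms `𝓘_{p,y_j} ≃ 𝓘_{p,y_{ℓ*}}`" (p.105 l.53–56) and, summandwise, Prop.
9.7.5.1's collation isomorphisms (p.112) act on §9.4's codomain (functoriality of (9.4.6.2) in its inputs). [folklore] -/
def packetCongr (e : ∀ (y : 𝔇.Arith) (w : T.V), IQ y w ≃ₗ[𝕜] IQ' y w) (z : T.Label → 𝔇.Arith) (j : T.Label)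
    (p : T.VQ) : 𝔇.packetQ 𝕜 IQ z j p ≃ₗ[𝕜] 𝔇.packetQ 𝕜 IQ' z j p :=
  PiTensorProduct.congr fun a => LinearEquiv.piCongrRight fun w : T.Fibre p => e (𝔇.capsEntry z j a) w.1

/-- `packetCongr e` on a pure tensor: `⊗_a (x_{a,w})_w ↦ ⊗_a (e_{z_a,w} x_{a,w})_w`. [folklore] -/
theorem packetCongr_tprod (e : ∀ (y : 𝔇.Arith) (w : T.V), IQ y w ≃ₗ[𝕜] IQ' y w) (z : T.Label → 𝔇.Arith)
    (j : T.Label) (p : T.VQ) (x : 𝔇.prodPacketQ IQ z j p) :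
    𝔇.packetCongr 𝕜 e z j p (PiTensorProduct.tprod 𝕜 x) =
      PiTensorProduct.tprod 𝕜 fun a (w : T.Fibre p) => e (𝔇.capsEntry z j a) w.1 (x a w) :=
  PiTensorProduct.congr_tprod _ x

/-- The induced isomorphism of the codomains `𝓘^ℚ_Mochizuki(L') ≃ 𝓘'^ℚ_Mochizuki(L')` ((9.4.6.8)), componentwise in
`(p, j)`. [folklore] -/
def IQMochizukiCongr (e : ∀ (y : 𝔇.Arith) (w : T.V), IQ y w ≃ₗ[𝕜] IQ' y w) (z : T.Label → 𝔇.Arith) :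
    𝔇.IQMochizukiAt 𝕜 IQ z ≃ₗ[𝕜] 𝔇.IQMochizukiAt 𝕜 IQ' z :=
  LinearEquiv.piCongrRight fun p => LinearEquiv.piCongrRight fun j => 𝔇.packetCongr 𝕜 e z j.1 p

/-- `IQMochizukiCongr` on components. [folklore] -/
@[simp] theorem IQMochizukiCongr_apply (e : ∀ (y : 𝔇.Arith) (w : T.V), IQ y w ≃ₗ[𝕜] IQ' y w)
    (z : T.Label → 𝔇.Arith) (x : 𝔇.IQMochizukiAt 𝕜 IQ z) (p : T.VQ) (j : T.LabelStar) :
    𝔇.IQMochizukiCongr 𝕜 e z x p j = 𝔇.packetCongr 𝕜 e z j.1 p (x p j) := rfl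

/-- Shadows transform by the packet isomorphism: the `(p, j)`-shadow of the image of `X` is the image of the
`(p, j)`-shadow (bookkeeping for slot T-22's loci under carrier-level moves). [folklore] -/
theorem packetShadows_image (e : ∀ (y : 𝔇.Arith) (w : T.V), IQ y w ≃ₗ[𝕜] IQ' y w) (z : T.Label → 𝔇.Arith)
    (X : Set (𝔇.IQMochizukiAt 𝕜 IQ z)) (p : T.VQ) (j : T.LabelStar) :
    𝔇.packetShadows (𝔇.IQMochizukiCongr 𝕜 e z '' X) p j = 𝔇.packetCongr 𝕜 e z j.1 p '' 𝔇.packetShadows X p j := by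
  simp only [packetShadows, Set.image_image, IQMochizukiCongr_apply]

end Congr

/-! ## 2. Under the strictification D-09: such moves are OUR `factorwise ∘ summandwise` packet automorphisms -/

section Ind

variable (L : LogShells T)

/-- **D-09 ∘ move = (Ind)-shape.** Under the strictification `ofLogShells L` (arithmeticoid forgotten, one carrier
`log(𝒟^⊢_w)` per place), the packet isomorphism induced by a family `g_{y,w}` of automorphisms of the carriers IS our
`LogShells.factorwise j p (a ↦ LogShells.summandwise p (w ↦ g_{z_a,w}))` — the form in which [IUTchIII] Thm. 3.11 (i)
(Ind1)/(Ind2) act on `𝓘^ℚ(^{S^±_{j+1}}𝒟^⊢_{v_ℚ})` (`Thm311.LogShells.Ind1`, `Ind2`); definitionally. [folklore] -/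
theorem packetCongr_ofLogShells (g : 𝔇.Arith → ∀ w : T.V, L.carrier w ≃ₗ[ℚ] L.carrier w)
    (z : T.Label → 𝔇.Arith) (j : T.Label) (p : T.VQ) :
    𝔇.packetCongr ℚ (IQ := 𝔇.ofLogShells L) (IQ' := 𝔇.ofLogShells L) g z j p =
      L.factorwise j p fun a => L.summandwise p fun w => g (𝔇.capsEntry z j a) w.1 := rfl

/-- **Sufficient condition for (Ind2).** If every local isomorphism `g_{z_a,w}`, `a ∈ S_{j+1}`, `w | p`, is an element
of `Ism` at `w` (`LogShells.ism`; [IUTchIII] Prop. 1.2 (vi)/(vii)), the induced packet automorphism at `(j, p)` lies in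
OUR (Ind2) ([IUTchIII] Thm. 3.11 (i): "independent copies of Ism … on each of the direct summands of the `j+1`
factors"). PROVED. [folklore] -/
theorem packetCongr_mem_Ind2 (g : 𝔇.Arith → ∀ w : T.V, L.carrier w ≃ₗ[ℚ] L.carrier w)
    (z : T.Label → 𝔇.Arith) (j : T.Label) (p : T.VQ)
    (hg : ∀ (a : T.Caps j) (w : T.Fibre p), g (𝔇.capsEntry z j a) w.1 ∈ L.ism w.1) :
    𝔇.packetCongr ℚ (IQ := 𝔇.ofLogShells L) (IQ' := 𝔇.ofLogShells L) g z j p ∈ L.Ind2 j p :=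
  ⟨fun a w => g (𝔇.capsEntry z j a) w.1, hg, rfl⟩

/-- **Sufficient condition for (Ind1).** If every local isomorphism `g_{z_a,v}`, `a ∈ S_{j+1}`, `v ∈ V`, is induced by
an isomorphism of `𝒟^⊢`-prime-strips (`LogShells.stripAut`; [IUTchIII] Prop. 1.2 (vi) functoriality), the family
over `v_ℚ` of induced packet automorphisms at label `j` lies in OUR (Ind1) ([IUTchIII] Thm. 3.11 (i): "the
automorphisms of the procession of `𝒟^⊢`-prime-strips"), with the identity permutation of `S_{j+1}` (Joshi's tuples
are ordered, §9.4.4). PROVED. [folklore] -/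
theorem packetCongr_mem_Ind1 (g : 𝔇.Arith → ∀ w : T.V, L.carrier w ≃ₗ[ℚ] L.carrier w)
    (z : T.Label → 𝔇.Arith) (j : T.Label) (hg : ∀ (a : T.Caps j) (v : T.V), g (𝔇.capsEntry z j a) v ∈ L.stripAut v) :
    (fun p : T.VQ => 𝔇.packetCongr ℚ (IQ := 𝔇.ofLogShells L) (IQ' := 𝔇.ofLogShells L) g z j p) ∈ L.Ind1 j := by
  refine ⟨Equiv.refl _, fun a v => g (𝔇.capsEntry z j a) v, hg, fun p => ?_⟩
  rw [LogShells.permute_refl, LinearEquiv.refl_trans]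
  rfl

/-- The family, over all `(j, v_ℚ)`, of packet automorphisms induced under the strictification by carrier
automorphisms `g_{y,w}` along the tuple `z` — an element of OUR `LogShells.PacketAut` (the group acting in Thm. 3.11
(i) and in S): the §9.4-codomain form of "a Joshi move acting on `𝓘_Mochizuki`" (E-plan `Joshi.Dictionary.real`,
rows D-04/D-10), as a candidate realisation, asserting nothing about any specific move. [folklore] -/
def strictMove (g : 𝔇.Arith → ∀ w : T.V, L.carrier w ≃ₗ[ℚ] L.carrier w) (z : T.Label → 𝔇.Arith) : L.PacketAut :=
  fun j p => 𝔇.packetCongr ℚ (IQ := 𝔇.ofLogShells L) (IQ' := 𝔇.ofLogShells L) g z j p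

/-- `strictMove g z` at `(j, p)` is the induced packet automorphism (under D-09 the `(p, j)`-component of
`IQMochizukiCongr`). [folklore] -/
theorem strictMove_apply (g : 𝔇.Arith → ∀ w : T.V, L.carrier w ≃ₗ[ℚ] L.carrier w) (z : T.Label → 𝔇.Arith)
    (j : T.Label) (p : T.VQ) :
    𝔇.strictMove L g z j p = L.factorwise j p fun a => L.summandwise p fun w => g (𝔇.capsEntry z j a) w.1 := rfl

/-- Summandwise-`Ism` carrier moves give an (Ind2)-FAMILY (`LogShells.Ind2Family`). PROVED. [folklore] -/
theorem strictMove_mem_Ind2Family (g : 𝔇.Arith → ∀ w : T.V, L.carrier w ≃ₗ[ℚ] L.carrier w)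
    (z : T.Label → 𝔇.Arith) (hg : ∀ (y : 𝔇.Arith) (w : T.V), g y w ∈ L.ism w) :
    𝔇.strictMove L g z ∈ L.Ind2Family :=
  fun j p => 𝔇.packetCongr_mem_Ind2 L g z j p fun _ _ => hg _ _

/-- Strip-automorphism carrier moves give an (Ind1)-FAMILY (`LogShells.Ind1Family`). PROVED. [folklore] -/
theorem strictMove_mem_Ind1Family (g : 𝔇.Arith → ∀ w : T.V, L.carrier w ≃ₗ[ℚ] L.carrier w)
    (z : T.Label → 𝔇.Arith) (hg : ∀ (y : 𝔇.Arith) (w : T.V), g y w ∈ L.stripAut w) :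
    𝔇.strictMove L g z ∈ L.Ind1Family :=
  fun j => 𝔇.packetCongr_mem_Ind1 L g z j fun _ _ => hg _ _

/-- **Where S sees such a move.** In either case the induced family lies in the subgroup
`Subgroup.closure (Ind1Family ∪ Ind2Family)` generated by OUR indeterminacy families — the group over which
`Cor312.Setting.indGroup`, the residual S = `Cor312Vol.PilotKummerIndRelated` (through `RLGP`) and E-plan's
`Joshi.Dictionary.MovesAreInd` quantify. PROVED (sufficient conditions only; whether Joshi's amphoric / collation
isomorphisms — "all (topological) isomorphisms", [J-III] p.112 l.65–70 — meet them at the real instantiation is row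
D-10 / Y1, open). [folklore] -/
theorem strictMove_mem_indClosure (g : 𝔇.Arith → ∀ w : T.V, L.carrier w ≃ₗ[ℚ] L.carrier w)
    (z : T.Label → 𝔇.Arith)
    (hg : (∀ (y : 𝔇.Arith) (w : T.V), g y w ∈ L.stripAut w) ∨ ∀ (y : 𝔇.Arith) (w : T.V), g y w ∈ L.ism w) :
    𝔇.strictMove L g z ∈ Subgroup.closure (L.Ind1Family ∪ L.Ind2Family) :=
  Subgroup.subset_closure <|
    hg.elim (fun h => Or.inl (𝔇.strictMove_mem_Ind1Family L g z h))
      fun h => Or.inr (𝔇.strictMove_mem_Ind2Family L g z h)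

/-- The (9.4.8.3) RELABELLING under strictification. After forgetting the arithmeticoid, Rmk. 9.4.8.2's amphoric
identifications `𝓘_{p,y_j} ≃ 𝓘_{p,y_{ℓ*}}` (p.105 l.53–56) are AUTOMORPHISMS `amph_{j,w}` of the common carrier
`log(𝒟^⊢_w)`; the identification `𝓘^ℚ_Mochizuki ≃ 𝓘^ℚ_Mochizuki` they induce is the strict move along the standard
tuple by `g_{y,w} := amph_{j,w}` whenever `y = y_j` is read off the label — typed for a family `g` indexed directly
by arithmeticoids. It is an indeterminacy of the typed Thm. 3.11 (i) under the sufficient conditions above; in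
general it is only SOME packet automorphism (this, not more, is what §9.4 gives). [folklore] -/
theorem strictMove_zTheta_mem_indClosure (g : 𝔇.Arith → ∀ w : T.V, L.carrier w ≃ₗ[ℚ] L.carrier w)
    (hg : (∀ (y : 𝔇.Arith) (w : T.V), g y w ∈ L.stripAut w) ∨ ∀ (y : 𝔇.Arith) (w : T.V), g y w ∈ L.ism w) :
    𝔇.strictMove L g 𝔇.zTheta ∈ Subgroup.closure (L.Ind1Family ∪ L.Ind2Family) :=
  𝔇.strictMove_mem_indClosure L g 𝔇.zTheta hg

/-- The identity carrier move is the identity family (sanity: no data is forced to move). [folklore] -/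
theorem strictMove_refl (z : T.Label → 𝔇.Arith) :
    𝔇.strictMove L (fun _ w => LinearEquiv.refl ℚ (L.carrier w)) z = fun j p => LinearEquiv.refl ℚ (L.Packet j p) := by
  funext j p
  rw [strictMove_apply, LogShells.summandwise_refl_family, LogShells.factorwise_refl]

end Ind

end TensorPacketDatum

end Summit.ABC.IUTFork.Joshi

end
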